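import Summits.HubbardSuperconductivity.HubbardSuperconductivity.Theorems.AnisotropyChordSpinMonotoneTwoMagnonRookWeightedSymmetric
import Summits.HubbardSuperconductivity.HubbardSuperconductivity.Theorems.AnisotropyChordSpinMonotoneTwoMagnonRookOverlap

/-!
# Route `AnisotropyChord`: THEOREM R (weighted rook graphs), analytic form — every coupling ratio

Final assembly of the real-algebra form of THEOREM R: for real `p, q ≥ 1` and EVERY coupling ratio
`J > 0`, physical points of the three-class rook quotient at couplings `0 < σ₁ ≤ σ₂` have
`W(u₂,v₂) ≤ W(u₁,v₁)` (`wrook_flatOverlap_antitone_all`).  The case `J ≠ 1` is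
`wrook_flatOverlap_antitone_of_ne_one` (file `…RookWeightedSymmetric`, resting on the criterion
files); the equal-weight case `J = 1` (`wrook_flatOverlap_antitone_one`) is the exact one-parameter
solution `u = q/(q+t)`, `v = p/(p+t)`, `σ = t(1 + 1/(p+t) + 1/(q+t))`, `W = pq·Nu²/((p+q+pq)·De)`
of the unweighted rook theorem, read through `rook_le_of_sigma_le` and `rookOverlap_le`
(file `…TwoMagnonRookOverlap`).  No definition is introduced; graphs do not appear — the remaining
wrapper (Perron vector of `xxzHamiltonianWith` on `K_m □ K_n` is class-constant and its class values
are a physical point) is routine bookkeeping over the weighted toolkit `…XXZWeightedHopping/Pair`.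
-/

set_option linter.dupNamespace false

namespace Summit.HubbardSuperconductivity.HubbardSuperconductivity.Theorems.AnisotropyChord.TwoMagnon

/-- **Equal weights (`J = 1`)**: physical points at `0 < σ₁ ≤ σ₂` satisfy `W(u₂,v₂) ≤ W(u₁,v₁)` —
the one-parameter solution `t = σ − E`, `u = q/(q+t)`, `v = p/(p+t)` of the unweighted rook theorem
(`rook_le_of_sigma_le`, `rookOverlap_le`). [folklore] -/
theorem wrook_flatOverlap_antitone_one (p q : ℝ) (hp : 1 ≤ p) (hq : 1 ≤ q)
    {σ₁ E₁ u₁ v₁ σ₂ E₂ u₂ v₂ : ℝ} (hσ₁ : 0 < σ₁) (h12 : σ₁ ≤ σ₂)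
    (hu₁ : 0 < u₁) (hv₁ : 0 < v₁) (hu₂ : 0 < u₂) (hv₂ : 0 < v₂)
    (a1 : u₁ * (1 * q + σ₁ - E₁) = 1 * q) (a2 : v₁ * (p + σ₁ * 1 - E₁) = p)
    (a3 : E₁ = (1 - v₁) + 1 * (1 - u₁))
    (b1 : u₂ * (1 * q + σ₂ - E₂) = 1 * q) (b2 : v₂ * (p + σ₂ * 1 - E₂) = p)
    (b3 : E₂ = (1 - v₂) + 1 * (1 - u₂)) :
    (p * u₂ + q * v₂ + p * q) ^ 2 / ((p + q + p * q) * (p * u₂ ^ 2 + q * v₂ ^ 2 + p * q))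
      ≤ (p * u₁ + q * v₁ + p * q) ^ 2 / ((p + q + p * q) * (p * u₁ ^ 2 + q * v₁ ^ 2 + p * q)) := by
  have hp0 : 0 < p := by linarith
  have hq0 : 0 < q := by linarith
  obtain ⟨hE₁, _, _⟩ := wrook_ranges hp hq one_pos le_rfl hσ₁ hu₁ hv₁ a1 a2 a3
  obtain ⟨hE₂, _, _⟩ := wrook_ranges hp hq one_pos le_rfl (lt_of_lt_of_le hσ₁ h12) hu₂ hv₂ b1 b2 b3
  -- the parameters `tᵢ = σᵢ − Eᵢ > 0` and the explicit class values
  set t₁ := σ₁ - E₁ with ht₁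
  set t₂ := σ₂ - E₂ with ht₂
  have ht₁0 : 0 < t₁ := by rw [ht₁]; linarith
  have ht₂0 : 0 < t₂ := by rw [ht₂]; linarith
  have hqt₁ : 0 < q + t₁ := by linarith
  have hpt₁ : 0 < p + t₁ := by linarith
  have hqt₂ : 0 < q + t₂ := by linarith
  have hpt₂ : 0 < p + t₂ := by linarith
  have hu₁e : u₁ = q / (q + t₁) := by
    rw [eq_div_iff hqt₁.ne']; linear_combination a1
  have hv₁e : v₁ = p / (p + t₁) := by
    rw [eq_div_iff hpt₁.ne']; linear_combination a2
  have hu₂e : u₂ = q / (q + t₂) := by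
    rw [eq_div_iff hqt₂.ne']; linear_combination b1
  have hv₂e : v₂ = p / (p + t₂) := by
    rw [eq_div_iff hpt₂.ne']; linear_combination b2
  -- the couplings along the family
  have hσ₁e : σ₁ = t₁ * (1 + 1 / (p + t₁) + 1 / (q + t₁)) := by
    have : σ₁ = t₁ + E₁ := by rw [ht₁]; ring
    rw [this, a3, hu₁e, hv₁e]
    field_simp
    ring
  have hσ₂e : σ₂ = t₂ * (1 + 1 / (p + t₂) + 1 / (q + t₂)) := by
    have : σ₂ = t₂ + E₂ := by rw [ht₂]; ring
    rw [this, b3, hu₂e, hv₂e]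
    field_simp
    ring
  have ht12 : t₁ ≤ t₂ :=
    rook_le_of_sigma_le hp0 hq0 ht₂0.le (by rw [← hσ₁e, ← hσ₂e]; exact h12)
  have hov := rookOverlap_le hp0 hq0 ht₁0.le ht12
  -- the flat overlap along the family: `W = pq·Nu²/De / (p+q+pq)`
  have hn : 0 < p + q + p * q := by positivity
  have hW : ∀ t : ℝ, 0 < t →
      (p * (q / (q + t)) + q * (p / (p + t)) + p * q) ^ 2 /
          ((p + q + p * q) * (p * (q / (q + t)) ^ 2 + q * (p / (p + t)) ^ 2 + p * q))
        = p * q * (((p + t) * (q + t) + (p + t) + (q + t)) ^ 2 /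
          ((p + t) ^ 2 * (q + t) ^ 2 + p * (q + t) ^ 2 + q * (p + t) ^ 2)) / (p + q + p * q) := by
    intro t ht
    have h1 : 0 < p + t := by linarith
    have h2 : 0 < q + t := by linarith
    have h3 : 0 < (p + t) ^ 2 * (q + t) ^ 2 + p * (q + t) ^ 2 + q * (p + t) ^ 2 := by positivity
    field_simp
    ring
  rw [hu₁e, hv₁e, hu₂e, hv₂e, hW t₁ ht₁0, hW t₂ ht₂0]
  exact div_le_div_of_nonneg_right hov hn.le

/-- **THEOREM R, analytic form, every coupling ratio.**  For real `p, q ≥ 1` and `J > 0`, two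
physical points `(uᵢ, vᵢ, Eᵢ)` of the three-class quotient of the weighted rook graph
`K_{p+1} □ K_{q+1}` (direction weights `1, J`; positive solutions of (E1)–(E3)) at couplings
`0 < σ₁ ≤ σ₂` satisfy `W(u₂,v₂) ≤ W(u₁,v₁)`,
`W(u,v) = (pu + qv + pq)²/((p + q + pq)(pu² + qv² + pq))`: the two-magnon flat overlap is
non-increasing in `σ = 1 − Δ` for ALL anisotropies and ALL weight ratios.  Cases `J = 1`
(`wrook_flatOverlap_antitone_one`) and `J ≠ 1` (`wrook_flatOverlap_antitone_of_ne_one`).  Theory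
seat hubbard-h0-rotor-theory-1, ROTOR-THEORY-5 §41 (THEOREM R). [folklore] -/
theorem wrook_flatOverlap_antitone_all (p q J : ℝ) (hp : 1 ≤ p) (hq : 1 ≤ q) (hJ : 0 < J)
    {σ₁ E₁ u₁ v₁ σ₂ E₂ u₂ v₂ : ℝ} (hσ₁ : 0 < σ₁) (h12 : σ₁ ≤ σ₂)
    (hu₁ : 0 < u₁) (hv₁ : 0 < v₁) (hu₂ : 0 < u₂) (hv₂ : 0 < v₂)
    (a1 : u₁ * (J * q + σ₁ - E₁) = J * q) (a2 : v₁ * (p + σ₁ * J - E₁) = p)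
    (a3 : E₁ = (1 - v₁) + J * (1 - u₁))
    (b1 : u₂ * (J * q + σ₂ - E₂) = J * q) (b2 : v₂ * (p + σ₂ * J - E₂) = p)
    (b3 : E₂ = (1 - v₂) + J * (1 - u₂)) :
    (p * u₂ + q * v₂ + p * q) ^ 2 / ((p + q + p * q) * (p * u₂ ^ 2 + q * v₂ ^ 2 + p * q))
      ≤ (p * u₁ + q * v₁ + p * q) ^ 2 / ((p + q + p * q) * (p * u₁ ^ 2 + q * v₁ ^ 2 + p * q)) := by
  by_cases hJ1 : J = 1
  · subst hJ1
    exact wrook_flatOverlap_antitone_one p q hp hq hσ₁ h12 hu₁ hv₁ hu₂ hv₂ a1 a2 a3 b1 b2 b3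
  · exact wrook_flatOverlap_antitone_of_ne_one p q J hp hq hJ hJ1 hσ₁ h12 hu₁ hv₁ hu₂ hv₂ a1 a2 a3
      b1 b2 b3

end Summit.HubbardSuperconductivity.HubbardSuperconductivity.Theorems.AnisotropyChord.TwoMagnon
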